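import Mathlib
import Literature.NumberTheory.Automorphic.HilbertModularFormQExpansion
import Literature.Analysis.Complex.LocallyUniformLimitSCV
import Summits.Langlands.Langlands.Theorems.CapacityClassicalityHilbertIntegralOverconvergentIsCongruenceStubBoundedOfCoeffSupport

/-!
# Crux `HilbertIntegralOverconvergentIsCongruence` (stmt-Langlands-8485),
# line `Sketch-ideate-r1-k1`, section M: stub `stub_qSeries_holomorphic` (M-B3)

Section M of the line builds the `q`-series package on the tube domain `ℍ = halfSpace F` inside
`Point F = (F →+* ℝ) → ℂ`.  This file proves the registered stub: a `q`-series
`z ↦ ∑_{ν ∈ S} a_ν e^{2πi S(νz)}` whose coefficients satisfy `∑_ν |a_ν| e^{-2π ∑_σ σ(ν) y_σ} < ∞` at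
EVERY height `y ≫ 0` is holomorphic on `ℍ` (`HilbertModular.IsHolomorphicOn`).  Proof: every
`z₀ ∈ ℍ` lies in the open box `U = {z | Im z₀_σ / 2 < Im z_σ < 2 Im z₀_σ ∀σ}`; on `U` the `ν`-th
term has size `|a_ν| e^{-2π ∑_σ σ(ν) Im z_σ} ≤ |a_ν| e^{-2π ∑_σ σ(ν) w_σ}` for the corner height
`w` of the box with `w_σ = 2 Im z₀_σ` where `σ(ν) < 0` and `w_σ = Im z₀_σ / 2` otherwise, hence is
bounded by the sum over all `2^{[F:ℚ]}` corners, a summable majorant (each corner is a height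
`≫ 0`).  The tree's several-variable Weierstrass `M`-test
`Literature.Analysis.Complex.SCV.analyticOnNhd_tsum_of_summable_norm` then gives analyticity on
`U`, whence differentiability at `z₀`.
-/

set_option linter.dupNamespace false

noncomputable section

namespace Summit.Langlands.Langlands.Theorems.HilbertIntegralOverconvergentIsCongruence

open MeasureTheory Complex NumberField
open Literature.NumberTheory.Automorphic Literature.NumberTheory.Automorphic.HilbertModular

/-- The pairing `z ↦ S(νz) = ∑_σ σ(ν) z_σ` is `ℂ`-linear, hence entire on `ℂ^{Hom(F,ℝ)}`. -/
theorem qsh_differentiable_pairing {F : Type} [Field F] [NumberField F] (ν : F) :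
    Differentiable ℂ (fun z : Point F ↦ pairing ν z) := by
  unfold pairing
  fun_prop

/-- Each `q`-monomial `z ↦ a e^{2πi S(νz)}` is entire on `ℂ^{Hom(F,ℝ)}`. -/
theorem qsh_differentiable_term {F : Type} [Field F] [NumberField F] (a : ℂ) (ν : F) :
    Differentiable ℂ (fun z : Point F ↦ a * cexp (2 * Real.pi * I * pairing ν z)) :=
  (((qsh_differentiable_pairing ν).const_mul _).cexp).const_mul _

/-- An open box of heights `{z | y_σ < Im z_σ < Y_σ ∀σ}` is open in `ℂ^{Hom(F,ℝ)}` (a finite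
intersection of open slabs). -/
theorem qsh_isOpen_box {F : Type} [Field F] [NumberField F] (y Y : (F →+* ℝ) → ℝ) :
    IsOpen {z : Point F | ∀ σ, y σ < (z σ).im ∧ (z σ).im < Y σ} := by
  rw [Set.setOf_forall]
  refine isOpen_iInter_of_finite fun σ ↦ ?_
  rw [Set.setOf_and]
  exact (isOpen_lt continuous_const (Complex.continuous_im.comp (continuous_apply σ))).inter
    (isOpen_lt (Complex.continuous_im.comp (continuous_apply σ)) continuous_const)

/-- The corner inequality: if `y_σ ≤ t_σ ≤ Y_σ` for all `σ`, then for any real coefficients `c_σ`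
the corner `w_σ = Y_σ` (where `c_σ < 0`), `w_σ = y_σ` (otherwise) satisfies
`∑_σ c_σ w_σ ≤ ∑_σ c_σ t_σ`. -/
theorem qsh_corner_sum_le {ι : Type*} [Fintype ι] (c t y Y : ι → ℝ) (hy : ∀ σ, y σ ≤ t σ)
    (hY : ∀ σ, t σ ≤ Y σ) :
    ∑ σ, c σ * (if c σ < 0 then Y σ else y σ) ≤ ∑ σ, c σ * t σ := by
  refine Finset.sum_le_sum fun σ _ ↦ ?_
  split_ifs with h
  · exact mul_le_mul_of_nonpos_left (hY σ) h.le
  · exact mul_le_mul_of_nonneg_left (hy σ) (not_lt.1 h)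

/-- **Stub M-B3 — `stub_qSeries_holomorphic`.** A `q`-series `∑_{ν ∈ S} a_ν e^{2πi S(νz)}` with
`∑ |a_ν| e^{-2π⟨ν,y⟩} < ∞` at every height `y ≫ 0` is holomorphic on `ℍ` (normal convergence on
every open box of heights `{y_σ < Im z_σ < Y_σ}`, dominated by the sum of the majorants at the
`2^{[F:ℚ]}` corner heights; the tree's several-variable Weierstrass theorem
`Literature.Analysis.Complex.SCV.analyticOnNhd_tsum_of_summable_norm`). [folklore] -/
theorem stub_qSeries_holomorphic (F : Type) [Field F] [NumberField F] (S : Set F) (a : F → ℂ)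
    (habs : ∀ y : (F →+* ℝ) → ℝ, (∀ σ, 0 < y σ) →
      Summable (fun ν : S ↦ ‖a ν‖ * Real.exp (-(2 * Real.pi * ∑ σ : F →+* ℝ, σ (ν : F) * y σ)))) :
    IsHolomorphicOn F (fun z ↦ ∑' ν : S, a ν * cexp (2 * Real.pi * I * pairing (ν : F) z)) := by
  classical
  intro z₀ hz₀
  have hz₀' : ∀ σ, 0 < (z₀ σ).im := mem_halfSpace_iff.1 hz₀
  -- the open box of heights around `z₀`
  set y : (F →+* ℝ) → ℝ := fun σ ↦ (z₀ σ).im / 2 with hy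
  set Y : (F →+* ℝ) → ℝ := fun σ ↦ 2 * (z₀ σ).im with hY
  set U : Set (Point F) := {z | ∀ σ, y σ < (z σ).im ∧ (z σ).im < Y σ}
  have hz₀U : z₀ ∈ U := fun σ ↦ ⟨by rw [hy]; linarith [hz₀' σ], by rw [hY]; linarith [hz₀' σ]⟩
  -- the `2^{[F:ℚ]}` corner heights of the box, all `≫ 0`
  set corner : ((F →+* ℝ) → Bool) → (F →+* ℝ) → ℝ := fun w σ ↦ if w σ then Y σ else y σ
    with hcorner
  have hcorner_pos : ∀ w σ, 0 < corner w σ := fun w σ ↦ by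
    rw [hcorner]
    dsimp only
    split_ifs
    · rw [hY]; linarith [hz₀' σ]
    · rw [hy]; linarith [hz₀' σ]
  -- the summable majorant: sum of the majorants at all corner heights
  have hu : Summable fun ν : S ↦ ∑ w : (F →+* ℝ) → Bool,
      ‖a ν‖ * Real.exp (-(2 * Real.pi * ∑ σ : F →+* ℝ, σ (ν : F) * corner w σ)) :=
    summable_sum fun w _ ↦ habs (corner w) (hcorner_pos w)
  -- termwise domination on the box
  have hbound : ∀ ν : S, ∀ z ∈ U, ‖a ν * cexp (2 * Real.pi * I * pairing (ν : F) z)‖ ≤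
      ∑ w : (F →+* ℝ) → Bool,
        ‖a ν‖ * Real.exp (-(2 * Real.pi * ∑ σ : F →+* ℝ, σ (ν : F) * corner w σ)) := by
    intro ν z hz
    rw [bcs_norm_term, ← Finset.mul_sum]
    refine mul_le_mul_of_nonneg_left ?_ (norm_nonneg _)
    -- the corner adapted to the signs of `σ(ν)`
    set w₀ : (F →+* ℝ) → Bool := fun σ ↦ decide (σ (ν : F) < 0) with hw₀
    refine le_trans ?_ (Finset.single_le_sum
      (f := fun w ↦ Real.exp (-(2 * Real.pi * ∑ σ : F →+* ℝ, σ (ν : F) * corner w σ)))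
      (fun w _ ↦ (Real.exp_pos _).le) (Finset.mem_univ w₀))
    refine Real.exp_le_exp.2 (neg_le_neg (mul_le_mul_of_nonneg_left ?_ (by positivity)))
    have hc : ∀ σ, corner w₀ σ = if σ (ν : F) < 0 then Y σ else y σ := fun σ ↦ by
      rw [hcorner, hw₀]
      by_cases h : σ (ν : F) < 0 <;> simp [h]
    simp only [hc]
    exact qsh_corner_sum_le _ _ _ _ (fun σ ↦ (hz σ).1.le) (fun σ ↦ (hz σ).2.le)
  have hana := Literature.Analysis.Complex.SCV.analyticOnNhd_tsum_of_summable_norm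
    (f := fun (ν : S) (z : Point F) ↦ a ν * cexp (2 * Real.pi * I * pairing (ν : F) z))
    (qsh_isOpen_box y Y) (fun ν ↦ (qsh_differentiable_term (a ν) (ν : F)).differentiableOn) hu
    hbound
  exact (hana z₀ hz₀U).differentiableAt.differentiableWithinAt

end Summit.Langlands.Langlands.Theorems.HilbertIntegralOverconvergentIsCongruence
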